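import Summits.AtomisticToContinuum.BoseEinsteinCondensation.Theses.BECConjugateDomination
import Literature.MathematicalPhysics.QuantumManyBody.CouplingPathSliceFloor
import Literature.MathematicalPhysics.QuantumManyBody.PeriodicTorusCalculus
import Literature.MathematicalPhysics.QuantumManyBody.PeriodicEnergyFirstVariation
import Literature.MathematicalPhysics.QuantumManyBody.LiebYngvasonCellMethod
import Literature.MathematicalPhysics.QuantumManyBody.BoseGasMergeOccupation
import Mathlib.Analysis.InnerProductSpace.Laplacian
import Mathlib.GroupTheory.Perm.Fin

/-!
# Route `BECConjugateDomination`, crux `PuffFloor` (stmt-AtomisticToContinuum-11785),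
# line `coupling-slope-pocket`, stub S7a `stub_weakPairSubsolution` — tools

Supports (does not close) stmt-AtomisticToContinuum-11785. Two self-contained tools for the weak pair
subsolution inequality of the registered skeleton v6 (`Cruxes/PuffFloor/Lines/coupling_slope_pocket.lean`):

* the calculus of a pair test function `F(X) = f(x₀ − x₁)` on `(ℝ³)^{n+2}` — its coordinate Laplacian is
  `∑_{i,a} ∂_{i,a}∂_{i,a}F = 2 (Δf)(x₀ − x₁)` (`configLaplacian_pairTest`);
* the **slice floor for a frozen pair**: for a periodic Bose-symmetric `C¹` state `Ψ` of `n+2` particles and a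
  weight `f(x₀ − x₁) ≥ 0` depending on the pair only,
  `E₀^per(n, L) ∫ f(x₀−x₁)|Ψ|² ≤ ∫ f(x₀−x₁)(|∇Ψ|² + ∑_{i<j}v^per|Ψ|²)` (`slice_floor_pair`,
  `slice_floor_pair_real`): Tonelli with the two frozen coordinates outermost and the variational principle
  for the (unnormalised, `C¹`, periodic, Bose-symmetric) double slice `Y ↦ Ψ(x₀, x₁, Y)`, whose kinetic
  density and interaction are dominated by those of `Ψ`.

References: LSSY2005 Ch. 2 (variational principle); Fournais2020 (1.1)–(1.2) (periodic form).
-/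

noncomputable section

namespace Summit.AtomisticToContinuum.BoseEinsteinCondensation.Theorems

open MeasureTheory Filter
open scoped ENNReal NNReal BigOperators InnerProductSpace Laplacian
open Literature.MathematicalPhysics.QuantumManyBody.BoseGas

/-- The coordinate unit vector `e_{i,a}` of `(ℝ³)^N` (particle `i`, axis `a`), local notation. -/
local notation3 "𝐞[" i ", " a "]" => (Pi.single i (EuclideanSpace.single a (1 : ℝ)) : Config _)

namespace PuffFloorWeakPairSubsolution

variable {n : ℕ} {L : ℝ}

/-! ## The pair test function `F(X) = f(x₀ − x₁)` -/

/-- Chain rule for the pair test function: `D(f(x₀−x₁))(X) w = Df(x₀−x₁)(w₀ − w₁)`. [folklore] -/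
theorem fderiv_pairTest_apply {f : Space → ℝ} (hf : Differentiable ℝ f) (X w : Config (n + 2)) :
    fderiv ℝ (fun Y : Config (n + 2) => f (Y 0 - Y 1)) X w = fderiv ℝ f (X 0 - X 1) (w 0 - w 1) := by
  set T := (ContinuousLinearMap.proj (R := ℝ) (φ := fun _ : Fin (n + 2) => Space) 0) -
      (ContinuousLinearMap.proj (R := ℝ) (φ := fun _ : Fin (n + 2) => Space) 1) with hT
  have h : HasFDerivAt (fun Y : Config (n + 2) => f (Y 0 - Y 1))
      ((fderiv ℝ f (X 0 - X 1)).comp T) X :=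
    (hf (X 0 - X 1)).hasFDerivAt.comp X T.hasFDerivAt
  rw [h.fderiv]
  rfl

/-- `(1 : Fin (n+2)) ≠ 0`. [folklore] -/
theorem fin_one_ne_zero : (1 : Fin (n + 2)) ≠ 0 := by
  simp

/-- Components of the coordinate vectors: `e_{0,a}` has pair difference `u_a`, `e_{1,a}` has `−u_a`,
`e_{j+2,a}` has `0`. [folklore] -/
theorem single_pairDiff (a : Fin 3) :
    ((𝐞[(0 : Fin (n + 2)), a] : Config (n + 2)) 0 - (𝐞[(0 : Fin (n + 2)), a] : Config (n + 2)) 1 =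
        EuclideanSpace.single a (1 : ℝ)) ∧
    ((𝐞[(1 : Fin (n + 2)), a] : Config (n + 2)) 0 - (𝐞[(1 : Fin (n + 2)), a] : Config (n + 2)) 1 =
        -EuclideanSpace.single a (1 : ℝ)) ∧
    ∀ j : Fin n, ((𝐞[j.succ.succ, a] : Config (n + 2)) 0 - (𝐞[j.succ.succ, a] : Config (n + 2)) 1 = 0) := by
  refine ⟨?_, ?_, fun j => ?_⟩
  · rw [Pi.single_eq_same, Pi.single_eq_of_ne fin_one_ne_zero, sub_zero]
  · rw [Pi.single_eq_same, Pi.single_eq_of_ne fin_one_ne_zero.symm, zero_sub]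
  · have h0 : (0 : Fin (n + 2)) ≠ j.succ.succ := (Fin.succ_ne_zero _).symm
    have h1 : (1 : Fin (n + 2)) ≠ j.succ.succ := by
      rw [show (1 : Fin (n + 2)) = (0 : Fin (n + 1)).succ from rfl, Ne, Fin.succ_inj]
      exact (Fin.succ_ne_zero _).symm
    rw [Pi.single_eq_of_ne h0, Pi.single_eq_of_ne h1, sub_zero]

/-- Second directional derivative of `f` along `u`, as `D(Df · u) u`; it is even in `u`. [folklore] -/
theorem fderiv_fderiv_apply_neg {f : Space → ℝ} (x u : Space) :
    fderiv ℝ (fun y => fderiv ℝ f y (-u)) x (-u) = fderiv ℝ (fun y => fderiv ℝ f y u) x u := by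
  have h : (fun y => fderiv ℝ f y (-u)) = -(fun y => fderiv ℝ f y u) := funext fun y => map_neg _ _
  rw [h, fderiv_neg]
  show -(fderiv ℝ (fun y => fderiv ℝ f y u) x (-u)) = _
  rw [map_neg, neg_neg]

/-- For `f ∈ C²`, `D(Df · u)(x) u = D²f(x)(u,u)`. [folklore] -/
theorem fderiv_fderiv_apply_eq_iteratedFDeriv {f : Space → ℝ} (hf : ContDiff ℝ 2 f) (x u : Space) :
    fderiv ℝ (fun y => fderiv ℝ f y u) x u = iteratedFDeriv ℝ 2 f x ![u, u] := by
  have hd : DifferentiableAt ℝ (fderiv ℝ f) x :=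
    ((hf.fderiv_right (m := 1) le_rfl).differentiable one_ne_zero) x
  rw [iteratedFDeriv_two_apply, fderiv_clm_apply hd (differentiableAt_const u)]
  simp

/-- The Laplacian of `f ∈ C²(ℝ³)` as the sum of the pure second derivatives along the standard basis.
[folklore] -/
theorem laplacian_eq_sum_fderiv_fderiv {f : Space → ℝ} (hf : ContDiff ℝ 2 f) (x : Space) :
    (Δ f) x = ∑ a : Fin 3, fderiv ℝ (fun y => fderiv ℝ f y (EuclideanSpace.single a (1 : ℝ))) x
      (EuclideanSpace.single a (1 : ℝ)) := by
  rw [InnerProductSpace.laplacian_eq_iteratedFDeriv_orthonormalBasis f (EuclideanSpace.basisFun (Fin 3) ℝ)]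
  refine Finset.sum_congr rfl fun a _ => ?_
  rw [fderiv_fderiv_apply_eq_iteratedFDeriv hf]
  simp

/-- **The coordinate Laplacian of a pair test function**: for `f ∈ C²(ℝ³)` and `F(X) = f(x₀ − x₁)` on
`(ℝ³)^{n+2}`, `∑_{i,a} ∂_{i,a}∂_{i,a}F(X) = 2 (Δf)(x₀ − x₁)` (particles `0` and `1` each contribute `Δf`,
the others nothing). [folklore] -/
theorem configLaplacian_pairTest {f : Space → ℝ} (hf : ContDiff ℝ 2 f) (X : Config (n + 2)) :
    (∑ i : Fin (n + 2), ∑ a : Fin 3,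
      fderiv ℝ (fun Y : Config (n + 2) =>
        fderiv ℝ (fun Z : Config (n + 2) => f (Z 0 - Z 1)) Y 𝐞[i, a]) X 𝐞[i, a]) =
      2 * (Δ f) (X 0 - X 1) := by
  have hfd : Differentiable ℝ f := hf.differentiable (by norm_num)
  have hgd : ∀ u : Space, Differentiable ℝ fun y => fderiv ℝ f y u := fun u =>
    ((hf.fderiv_right (m := 1) le_rfl).clm_apply contDiff_const).differentiable one_ne_zero
  -- first derivatives along the coordinate vectors
  have hfirst : ∀ (i : Fin (n + 2)) (a : Fin 3),
      (fun Y : Config (n + 2) => fderiv ℝ (fun Z : Config (n + 2) => f (Z 0 - Z 1)) Y 𝐞[i, a]) =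
        fun Y : Config (n + 2) => fderiv ℝ f (Y 0 - Y 1)
          ((𝐞[i, a] : Config (n + 2)) 0 - (𝐞[i, a] : Config (n + 2)) 1) :=
    fun i a => funext fun Y => fderiv_pairTest_apply hfd Y _
  -- second derivatives: the chain rule once more, for the function `y ↦ Df(y) u`
  have hsecond : ∀ (i : Fin (n + 2)) (a : Fin 3) (u : Space),
      fderiv ℝ (fun Y : Config (n + 2) => fderiv ℝ f (Y 0 - Y 1) u) X 𝐞[i, a] =
        fderiv ℝ (fun y => fderiv ℝ f y u) (X 0 - X 1)
          ((𝐞[i, a] : Config (n + 2)) 0 - (𝐞[i, a] : Config (n + 2)) 1) :=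
    fun i a u => fderiv_pairTest_apply (f := fun y => fderiv ℝ f y u) (hgd u) X _
  simp_rw [hfirst, hsecond]
  rw [laplacian_eq_sum_fderiv_fderiv hf, Finset.mul_sum, Finset.sum_comm]
  refine Finset.sum_congr rfl fun a _ => ?_
  rw [Fin.sum_univ_succ, Fin.sum_univ_succ]
  have hrest : ∑ j : Fin n,
      fderiv ℝ (fun y => fderiv ℝ f y
        ((𝐞[j.succ.succ, a] : Config (n + 2)) 0 - (𝐞[j.succ.succ, a] : Config (n + 2)) 1)) (X 0 - X 1)
        ((𝐞[j.succ.succ, a] : Config (n + 2)) 0 - (𝐞[j.succ.succ, a] : Config (n + 2)) 1) = 0 := by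
    refine Finset.sum_eq_zero fun j _ => ?_
    rw [(single_pairDiff (n := n) a).2.2 j, map_zero]
  simp only [Fin.succ_zero_eq_one]
  rw [hrest, add_zero, (single_pairDiff (n := n) a).1, (single_pairDiff (n := n) a).2.1,
    fderiv_fderiv_apply_neg]
  ring

/-! ## The slice floor for a frozen pair -/

/-- The periodic interaction of the tail is at most that of the whole configuration (the pair terms are
non-negative). [folklore] -/
theorem periodicInteraction_le_vecCons (v : ℝ → ℝ≥0∞) (L : ℝ) {m : ℕ} (x : Space) (Y : Config m) :
    periodicInteraction v L Y ≤ periodicInteraction v L (Matrix.vecCons x Y : Config (m + 1)) := by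
  rw [periodicInteraction_succ v L (Matrix.vecCons x Y : Config (m + 1)), Matrix.tail_cons]
  exact le_add_self

/-- The kinetic density of the slice `Y ↦ Ψ(x, Y)` is at most the kinetic density of `Ψ` at `(x, Y)`.
[folklore] -/
theorem kineticDensity_slice_le {m : ℕ} {Ψ : Config (m + 1) → ℂ} (hΨ : Differentiable ℝ Ψ) (x : Space)
    (Y : Config m) :
    kineticDensity (fun Z : Config m => Ψ (Matrix.vecCons x Z)) Y ≤
      kineticDensity Ψ (Matrix.vecCons x Y : Config (m + 1)) := by
  rw [kineticDensity_vecCons_slice hΨ x Y, ← taggedKineticDensity_one]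
  exact taggedKineticDensity_mono zero_le_one Ψ _

/-- Measurability of the periodic pair interaction of a measurable profile. [folklore] -/
theorem measurable_periodicInteraction' {v : ℝ → ℝ≥0∞} (hv : Measurable v) (L : ℝ) {m : ℕ} :
    Measurable fun X : Config m => periodicInteraction v L X := by
  unfold periodicInteraction
  refine Finset.measurable_sum _ fun i _ => Finset.measurable_sum _ fun j _ => ?_
  have hp : Measurable (periodizedPotential v L) := by
    show Measurable fun x => ∑' q : Fin 3 → ℤ, v ‖x - latticeVec L q‖
    exact Measurable.tsum fun q => hv.comp (measurable_id.sub_const _).norm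
  exact hp.comp ((measurable_pi_apply i).sub (measurable_pi_apply j))

/-- Inserting a frozen head particle is measurable. [folklore] -/
theorem measurable_vecCons_right {m : ℕ} (x : Space) :
    Measurable fun Y : Config m => (Matrix.vecCons x Y : Config (m + 1)) :=
  (contDiff_vecCons_right (n := 1) x).continuous.measurable

/-- **Slice floor for a frozen pair** (`ℝ≥0∞` form). For a periodic Bose-symmetric `C¹` state `Ψ` of `n+2`
particles on the torus of side `L` and a measurable weight `f` of the pair difference,
`E₀^per(n, L) · ∫ f(x₀−x₁)|Ψ|² ≤ ∫ f(x₀−x₁) (|∇Ψ|² + (∑_{i<j}v^per)|Ψ|²)`: Tonelli with `x₀, x₁`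
outermost (`setLIntegral_cellN_succ_left` twice), the variational principle for the double slice
`Y ↦ Ψ(x₀,x₁,Y)` (`periodicGroundStateEnergy_mul_normSq_le`: `C¹`, periodic, Bose-symmetric), and the
pointwise dominations of its kinetic density and interaction by those of `Ψ`. [cite: LSSY2005, Ch. 2 (2.3)] -/
theorem slice_floor_pair {v : ℝ → ℝ≥0∞} (hv : Measurable v) (Ψ : PeriodicTrialState (n + 2) L)
    {f : Space → ℝ} (hf : Measurable f) :
    periodicGroundStateEnergy v n L *
        ∫⁻ X in cellN (n + 2) L, ENNReal.ofReal (f (X 0 - X 1)) * (‖Ψ.ψ X‖₊ : ℝ≥0∞) ^ 2 ≤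
      ∫⁻ X in cellN (n + 2) L, ENNReal.ofReal (f (X 0 - X 1)) *
        (kineticDensity Ψ.ψ X + periodicInteraction v L X * (‖Ψ.ψ X‖₊ : ℝ≥0∞) ^ 2) := by
  set ψ := Ψ.ψ with hψdef
  set E₀ := periodicGroundStateEnergy v n L with hE₀
  have hψ1 : ContDiff ℝ 1 ψ := Ψ.contDiff
  have hψd : Differentiable ℝ ψ := hψ1.differentiable one_ne_zero
  have hψm : Measurable ψ := hψ1.continuous.measurable
  have hn2 : Measurable fun X : Config (n + 2) => (‖ψ X‖₊ : ℝ≥0∞) ^ 2 :=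
    hψm.nnnorm.coe_nnreal_ennreal.pow_const _
  have hwm : Measurable fun X : Config (n + 2) => ENNReal.ofReal (f (X 0 - X 1)) :=
    ENNReal.measurable_ofReal.comp (hf.comp ((measurable_pi_apply 0).sub (measurable_pi_apply 1)))
  have hA : Measurable fun X : Config (n + 2) => ENNReal.ofReal (f (X 0 - X 1)) * (‖ψ X‖₊ : ℝ≥0∞) ^ 2 :=
    hwm.mul hn2
  have hB : Measurable fun X : Config (n + 2) => ENNReal.ofReal (f (X 0 - X 1)) *
      (kineticDensity ψ X + periodicInteraction v L X * (‖ψ X‖₊ : ℝ≥0∞) ^ 2) :=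
    hwm.mul ((measurable_kineticDensity hψ1).add ((measurable_periodicInteraction' hv L).mul hn2))
  -- Tonelli, twice, on both sides
  rw [setLIntegral_cellN_succ_left hA, setLIntegral_cellN_succ_left hB]
  have hA' : ∀ x : Space, Measurable fun X' : Config (n + 1) =>
      ENNReal.ofReal (f ((Matrix.vecCons x X' : Config (n + 2)) 0 - (Matrix.vecCons x X' : Config (n + 2)) 1)) *
        (‖ψ (Matrix.vecCons x X')‖₊ : ℝ≥0∞) ^ 2 := fun x => hA.comp (measurable_vecCons_right x)
  have hB' : ∀ x : Space, Measurable fun X' : Config (n + 1) =>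
      ENNReal.ofReal (f ((Matrix.vecCons x X' : Config (n + 2)) 0 - (Matrix.vecCons x X' : Config (n + 2)) 1)) *
        (kineticDensity ψ (Matrix.vecCons x X') + periodicInteraction v L (Matrix.vecCons x X' : Config (n + 2)) *
          (‖ψ (Matrix.vecCons x X')‖₊ : ℝ≥0∞) ^ 2) := fun x => hB.comp (measurable_vecCons_right x)
  simp_rw [setLIntegral_cellN_succ_left (hA' _), setLIntegral_cellN_succ_left (hB' _)]
  simp only [Matrix.cons_val_zero, Matrix.cons_val_one]
  -- pull the constant inside and compare fibrewise in `(x₀, x₁)`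
  refine (lintegral_const_mul_le _ _).trans (lintegral_mono fun x₀ => ?_)
  refine (lintegral_const_mul_le _ _).trans (lintegral_mono fun x₁ => ?_)
  -- the double slice
  set sl : Config n → ℂ := fun Y => ψ (Matrix.vecCons x₀ (Matrix.vecCons x₁ Y)) with hsl
  have hsl1 : ContDiff ℝ 1 sl :=
    hψ1.comp ((contDiff_vecCons_right x₀).comp (contDiff_vecCons_right x₁))
  have hslp : ∀ (Y : Config n) (j : Fin n) (a : Fin 3),
      sl (Y + Pi.single j (EuclideanSpace.single a L)) = sl Y := fun Y j a => by
    simp only [hsl]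
    rw [vecCons_add_single, vecCons_add_single]
    exact Ψ.periodic _ _ _
  have hsls : ∀ (σ : Equiv.Perm (Fin n)) (Y : Config n), sl (Y ∘ σ) = sl Y := fun σ Y => by
    simp only [hsl]
    rw [vecCons_comp_perm x₁ Y σ, vecCons_comp_perm x₀ _ _]
    exact Ψ.symm _ _
  have hslm : Measurable fun Y : Config n => (‖sl Y‖₊ : ℝ≥0∞) ^ 2 :=
    hsl1.continuous.measurable.nnnorm.coe_nnreal_ennreal.pow_const _
  have hvar := periodicGroundStateEnergy_mul_normSq_le v hsl1 hslp hsls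
  -- pointwise domination of the slice's energy density
  have hdom : ∀ Y : Config n, kineticDensity sl Y + periodicInteraction v L Y * (‖sl Y‖₊ : ℝ≥0∞) ^ 2 ≤
      kineticDensity ψ (Matrix.vecCons x₀ (Matrix.vecCons x₁ Y)) +
        periodicInteraction v L (Matrix.vecCons x₀ (Matrix.vecCons x₁ Y) : Config (n + 2)) *
          (‖ψ (Matrix.vecCons x₀ (Matrix.vecCons x₁ Y))‖₊ : ℝ≥0∞) ^ 2 := by
    intro Y
    have hk1 : kineticDensity sl Y ≤
        kineticDensity (fun X' : Config (n + 1) => ψ (Matrix.vecCons x₀ X')) (Matrix.vecCons x₁ Y) :=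
      kineticDensity_slice_le (Ψ := fun X' : Config (n + 1) => ψ (Matrix.vecCons x₀ X'))
        (hψd.comp ((contDiff_vecCons_right (n := 1) x₀).differentiable one_ne_zero)) x₁ Y
    have hk2 : kineticDensity (fun X' : Config (n + 1) => ψ (Matrix.vecCons x₀ X')) (Matrix.vecCons x₁ Y) ≤
        kineticDensity ψ (Matrix.vecCons x₀ (Matrix.vecCons x₁ Y)) :=
      kineticDensity_slice_le hψd x₀ _
    have hp : periodicInteraction v L Y ≤
        periodicInteraction v L (Matrix.vecCons x₀ (Matrix.vecCons x₁ Y) : Config (n + 2)) :=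
      (periodicInteraction_le_vecCons v L x₁ Y).trans (periodicInteraction_le_vecCons v L x₀ _)
    gcongr
    · exact hk1.trans hk2
  calc E₀ * ∫⁻ Y in cellN n L, ENNReal.ofReal (f (x₀ - x₁)) * (‖sl Y‖₊ : ℝ≥0∞) ^ 2
      = ENNReal.ofReal (f (x₀ - x₁)) * (E₀ * ∫⁻ Y in cellN n L, (‖sl Y‖₊ : ℝ≥0∞) ^ 2) := by
        rw [lintegral_const_mul _ hslm]; ring
    _ ≤ ENNReal.ofReal (f (x₀ - x₁)) *
          ∫⁻ Y in cellN n L, kineticDensity sl Y + periodicInteraction v L Y * (‖sl Y‖₊ : ℝ≥0∞) ^ 2 :=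
        mul_le_mul_right hvar _
    _ ≤ ENNReal.ofReal (f (x₀ - x₁)) *
          ∫⁻ Y in cellN n L, kineticDensity ψ (Matrix.vecCons x₀ (Matrix.vecCons x₁ Y)) +
            periodicInteraction v L (Matrix.vecCons x₀ (Matrix.vecCons x₁ Y) : Config (n + 2)) *
              (‖ψ (Matrix.vecCons x₀ (Matrix.vecCons x₁ Y))‖₊ : ℝ≥0∞) ^ 2 :=
        mul_le_mul_right (lintegral_mono hdom) _
    _ = _ := by
        rw [← lintegral_const_mul']
        exact ENNReal.ofReal_ne_top

/-! ## The slice floor in real form -/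

/-- `L eₖ` is the lattice vector of `eₖ ∈ ℤ³`. [folklore] -/
theorem latticeVec_single' (L : ℝ) (k : Fin 3) :
    latticeVec L (Pi.single k (1 : ℤ)) = EuclideanSpace.single k L := by
  ext j
  rw [show (latticeVec L (Pi.single k (1 : ℤ))) j = L * ((Pi.single k (1 : ℤ) : Fin 3 → ℤ) j : ℝ) from rfl,
    PiLp.single_apply]
  by_cases h : j = k
  · subst h; simp
  · simp [h]

/-- **Slice floor for a frozen pair, real form.** If the periodic interaction is `ofReal` of a continuous
`V ≥ 0`, the weight `f ≥ 0` is continuous and `E₀^per(n, L) < ∞`, then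
`E₀^per(n,L) ∫ f(x₀−x₁)|Ψ|² ≤ ∫ f(x₀−x₁)(|∇Ψ|² + V|Ψ|²)` as real Bochner integrals. [cite: LSSY2005, Ch. 2 (2.3)] -/
theorem slice_floor_pair_real {v : ℝ → ℝ≥0∞} (hv : Measurable v) (Ψ : PeriodicTrialState (n + 2) L)
    {V : Config (n + 2) → ℝ} (hVc : Continuous V) (hV0 : ∀ X, 0 ≤ V X)
    (hW : ∀ X : Config (n + 2), periodicInteraction v L X = ENNReal.ofReal (V X))
    {f : Space → ℝ} (hfc : Continuous f) (hf0 : ∀ z, 0 ≤ f z) (hE : periodicGroundStateEnergy v n L ≠ ⊤) :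
    (periodicGroundStateEnergy v n L).toReal * ∫ X in cellN (n + 2) L, f (X 0 - X 1) * ‖Ψ.ψ X‖ ^ 2 ≤
      ∫ X in cellN (n + 2) L, f (X 0 - X 1) * (kineticDensityReal Ψ.ψ X + V X * ‖Ψ.ψ X‖ ^ 2) := by
  have h := slice_floor_pair hv Ψ hfc.measurable
  have hψc : Continuous Ψ.ψ := Ψ.contDiff.continuous
  have hfX : Continuous fun X : Config (n + 2) => f (X 0 - X 1) :=
    hfc.comp ((continuous_apply 0).sub (continuous_apply 1))
  have hA0 : ∀ X : Config (n + 2), 0 ≤ f (X 0 - X 1) * ‖Ψ.ψ X‖ ^ 2 := fun X =>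
    mul_nonneg (hf0 _) (sq_nonneg _)
  have hB0 : ∀ X : Config (n + 2), 0 ≤ f (X 0 - X 1) * (kineticDensityReal Ψ.ψ X + V X * ‖Ψ.ψ X‖ ^ 2) :=
    fun X => mul_nonneg (hf0 _) (add_nonneg (kineticDensityReal_nonneg _ _) (mul_nonneg (hV0 X) (sq_nonneg _)))
  have hAi : IntegrableOn (fun X : Config (n + 2) => f (X 0 - X 1) * ‖Ψ.ψ X‖ ^ 2) (cellN (n + 2) L) volume :=
    integrableOn_cellN (hfX.mul (hψc.norm.pow 2)) L
  have hBi : IntegrableOn (fun X : Config (n + 2) =>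
      f (X 0 - X 1) * (kineticDensityReal Ψ.ψ X + V X * ‖Ψ.ψ X‖ ^ 2)) (cellN (n + 2) L) volume :=
    integrableOn_cellN (hfX.mul ((continuous_kineticDensityReal Ψ.contDiff).add
      (hVc.mul (hψc.norm.pow 2)))) L
  have hAeq : ∫⁻ X in cellN (n + 2) L, ENNReal.ofReal (f (X 0 - X 1)) * (‖Ψ.ψ X‖₊ : ℝ≥0∞) ^ 2 =
      ENNReal.ofReal (∫ X in cellN (n + 2) L, f (X 0 - X 1) * ‖Ψ.ψ X‖ ^ 2) := by
    rw [ofReal_integral_eq_lintegral_ofReal hAi (Eventually.of_forall hA0)]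
    refine lintegral_congr fun X => ?_
    rw [coe_nnnorm_sq_eq_ofReal, ← ENNReal.ofReal_mul (hf0 _)]
  have hBeq : ∫⁻ X in cellN (n + 2) L, ENNReal.ofReal (f (X 0 - X 1)) *
      (kineticDensity Ψ.ψ X + periodicInteraction v L X * (‖Ψ.ψ X‖₊ : ℝ≥0∞) ^ 2) =
      ENNReal.ofReal (∫ X in cellN (n + 2) L, f (X 0 - X 1) * (kineticDensityReal Ψ.ψ X + V X * ‖Ψ.ψ X‖ ^ 2)) := by
    rw [ofReal_integral_eq_lintegral_ofReal hBi (Eventually.of_forall hB0)]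
    refine lintegral_congr fun X => ?_
    rw [kineticDensity_eq_ofReal, hW, coe_nnnorm_sq_eq_ofReal, ← ENNReal.ofReal_mul (hV0 X),
      ← ENNReal.ofReal_add (kineticDensityReal_nonneg _ _) (mul_nonneg (hV0 X) (sq_nonneg _)),
      ← ENNReal.ofReal_mul (hf0 _)]
  rw [hAeq, hBeq, ← ENNReal.ofReal_toReal hE, ← ENNReal.ofReal_mul ENNReal.toReal_nonneg] at h
  exact (ENNReal.ofReal_le_ofReal_iff (integral_nonneg hB0)).1 h

end PuffFloorWeakPairSubsolution

open PuffFloorWeakPairSubsolution in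
/-- **Registered helper `puffFloor_sliceFloorPair`** (sub-goal of stmt-AtomisticToContinuum-11785 for the tools of stub
S7a): the slice floor for a frozen pair, `E₀^per(n,L)·∫f(x₀−x₁)|Ψ|² ≤ ∫f(x₀−x₁)(|∇Ψ|² + ∑v^per|Ψ|²)` —
`PuffFloorWeakPairSubsolution.slice_floor_pair`. LSSY2005 Ch. 2 (variational principle). -/
theorem puffFloor_sliceFloorPair :
    ∀ (n : ℕ) (L : ℝ) (v : ℝ → ℝ≥0∞), Measurable v → ∀ (Ψ : PeriodicTrialState (n + 2) L) (f : Space → ℝ),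
      Measurable f →
      periodicGroundStateEnergy v n L *
          ∫⁻ X in cellN (n + 2) L, ENNReal.ofReal (f (X 0 - X 1)) * (‖Ψ.ψ X‖₊ : ℝ≥0∞) ^ 2 ≤
        ∫⁻ X in cellN (n + 2) L, ENNReal.ofReal (f (X 0 - X 1)) *
          (kineticDensity Ψ.ψ X + periodicInteraction v L X * (‖Ψ.ψ X‖₊ : ℝ≥0∞) ^ 2) :=
  fun _n _L _v hv Ψ _f hf => slice_floor_pair hv Ψ hf

end Summit.AtomisticToContinuum.BoseEinsteinCondensation.Theorems

end
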